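import Summits.QuantumFields.YangMills.Theorems.BalabanUVNodesN20HybridClassLawCharacterisation
import Summits.QuantumFields.YangMills.Theorems.BalabanUVNodesN20BlockCaricatureAffinity

/-!
# BalabanUVNodes ∕ N20·N19′·N21 — THE CONDITIONAL HYBRID BOUND, DEPENDENCE-FREE (FILE T): for ANY two laws on the large-field configurations of `n` blocks, the ℓ¹ distance is at most
# `2·Σ_{i<n} ε_i` as soon as, block by block along ANY filtration, the two runs' CONDITIONAL probabilities «block `i` is large-field GIVEN the configuration of the blocks before it»
# differ by at most `ε_i` — no independence, no product structure; hence the class-law half of K3 stub 2 at a window key follows from a summable tower of per-block CONDITIONAL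
# two-run discrepancies (the (YG)-type letter localised to one coarse block at a time, WITHOUT the caricature)

Cell `pub-ymgap` (HUMAN RULING D-0062 Track A; work-bound push D-0149, director-ym №197), width seat `pub-ymgap-dag-n20-w1` (gen 7) on node N20 = NE7b; key item of this
seat's payload K3⁷ `SpineGivenEndpointR13SepCoPH` = stmt-QuantumFields-20544 (ASIDE; lineage of K3⁸ `SpineGivenEndpointR13SepCoPHV` = stmt-QuantumFields-27366, skeleton v6
b4e55110ab73e679 UNTOUCHED; `--kind proof --supports 20544 --as helper`, MIS-KEY rule R463 (4)(a)); COUNT-NEUTRAL.  Bus: CLAIM-24 ∕ INTENT-29.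
THEOREMS ONLY (0 def ∕ instance ∕ notation ∕ sorry); imports dag-n20-w4 p609004 `…N20HybridClassLawCharacterisation` (`exists_hybridNE7_of_target_of_classLawTV`) and this seat's FILE A
p611611 `…N20BlockCaricatureAffinity` (`abs_sub_le_half_sum_abs`) BY NAME.

WHY.  FILE Q (p635927) showed on the independent-block caricature that the two runs' configuration laws are ℓ¹-close by `2·Σ_i |q_i − p_i|` (swap the per-block rates one block at a
time).  Independence is the caricature's assumption, not the record's: Bałaban's blocks interact through the small-field background.  The hybrid argument, however, does NOT need
independence — only CONDITIONING.  A TOWER OF MARGINALS `P_0, P_1, …, P_n` (`P_i` = the law of the first `i` blocks' large-field configuration, a weight function on `(range i).powerset`;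
consistency `P_i(S) = P_{i+1}(S) + P_{i+1}(S ∪ {i})`) carries the conditional probabilities `π_i(S) = P_{i+1}(S ∪ {i}) ∕ P_i(S)` («block `i` large-field given the earlier configuration `S`»);
if the two runs' conditionals differ by at most `ε_i` for EVERY earlier configuration (division-free: `|P_{i+1}(S∪{i})·Q_i(S) − Q_{i+1}(S∪{i})·P_i(S)| ≤ ε_i·P_i(S)·Q_i(S)`), then ONE STEP
costs `ℓ¹(P_{i+1}, Q_{i+1}) ≤ ℓ¹(P_i, Q_i) + 2ε_i·(total of P)` (§1 ★★ `l1_succ_le_of_condDiscrepancy`), and the tower telescopes: ★★★ `l1_le_two_mul_sum_condDiscrepancy` —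
`Σ_{S ⊆ range n} |Q_n(S) − P_n(S)| ≤ |Q_0(∅) − P_0(∅)| + 2·(Σ_{i<n} ε_i)·P_0(∅)`, i.e. `≤ 2·Σ_{i<n} ε_i` for two probability towers (§2).  The caricature is the special case
`π_i ≡ p_i`, `κ_i ≡ q_i`, `ε_i = |q_i − p_i|` (independence = conditionals blind to the past).  §3 reads it in the tree's class-law currency along `K`: carriers `(range n_K).powerset`
(key values = configurations), ANY class weights `A B` with consistent towers and conditional discrepancies `ε_{K,i}` uniform in `|t| ≤ l₀`: every class-set gap of the normalised
laws is `≤ Σ_{i<n_K} ε_{K,i}` (★★ `classLawGap_le_sum_condDiscrepancy`), so with node U5's `Target` on the totals and `Σ_K Σ_i ε_{K,i} < ∞`, `Σ_i ε_{K,i} < 1`, SOME dials give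
`HybridNE7` (★★★ `exists_hybridNE7_of_target_of_condDiscrepancyTower`, dag-n20-w4's class-law road BY NAME) — NO independence anywhere.
LOCATED READING (for the plan's booked window key `kr := wkey`, CRIT-1, cdisprove-to-be; hypothesis SHAPES, nothing at the record): at a window key the class-law half of stub 2 is
served by the (YG)-type two-run letter in its weakest local form — «for each coarse block `b` of the window (any fixed order) and each large-field configuration of the blocks
before it, the two runs' CONDITIONAL probabilities that `b` is large-field differ by `ε_{K,b}`, uniformly in the source `|t| ≤ l₀`, with `Σ_K Σ_b ε_{K,b} < ∞`» — plus node U5's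
Target on the totals.  Conditional single-block large-field probabilities given a boundary configuration are the objects a cluster expansion controls run by run; the letter asks
only for their TWO-RUN difference, block by block.  Whether Bałaban's densities supply it is NOT claimed.

HONEST FRAMING.  [folklore] finite-sum probability (the chain rule ∕ hybrid argument for total variation along a filtration) on hypothesis SHAPES; nothing read at the record
(`classSet₁₃ ∕ weightA₁₃ ∕ weightB₁₃` untouched; (LS)∕(XG′)∕(SAT′) and the regime AT THE RECORD UNDECIDED); proves NO estimate of Bałaban's; refutes NO registered stub; nothing of Bałaban's
asserted or instantiated.  NE7 ∕ NE7b ∕ NE7c NOT PRINTED for `d = 4`, NOT proved; N19 ∕ N20 ∕ N21 NOT discharged; K3⁸ ∕ K3⁷ OPEN; counts unmoved (typed 28∕28 · discharged 5∕27); no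
count claim.  One finite `𝕋⁴_{L^K}` programme at fixed `ε = L^{−K}`, Bałaban AS PRINTED; the YM mass gap (Clay) is NOT proved by any of this — R4 closes the conditional finite-𝕋⁴
rung `BalabanLadder.UV` only; NOT ℝ⁴, NOT OS.  No decl carries a cite tag.
-/

noncomputable section

open Finset
open Literature.MathematicalPhysics.QuantumFieldTheory.Balaban1983to89
open Literature.MathematicalPhysics.QuantumFieldTheory.Balaban1983to89.T4MatchingAssembly (HybridNE7)
open Summit.QuantumFields.BalabanUV.T4Continuum.Spine.NE7 (Target)
open Summit.QuantumFields.YangMills.BalabanUVNodes.N20BlockCaricatureAffinity (abs_sub_le_half_sum_abs)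
open Summit.QuantumFields.YangMills.BalabanUVNodes.N20HybridClassLawCharacterisation (exists_hybridNE7_of_target_of_classLawTV)

namespace Summit.QuantumFields.YangMills.BalabanUVNodes.N20ClassLawConditionalHybridBound

/-! ## §1 One step of the chain rule: adding one block costs twice the conditional discrepancy -/

section OneStep

variable {ι : Type*} [DecidableEq ι]

/-- The two-atom inequality behind the step [folklore]: for non-negative `x₀ x₁ y₀ y₁` with `X = x₀ + x₁`, `Y = y₀ + y₁`,
`|x₀ − y₀| + |x₁ − y₁| ≤ |X − Y| + 2·|x₁·Y − y₁·X| ∕ Y` — the second term is `2·X·|x₁∕X − y₁∕Y|`, TWICE THE `X`-WEIGHTED CONDITIONAL GAP (and `0` when `Y = 0`, where the bound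
reads `X ≤ X`; Lean's `x ∕ 0 = 0`). -/
theorem abs_sub_add_abs_sub_le_condGap {x₀ x₁ y₀ y₁ : ℝ} (hx₀ : 0 ≤ x₀) (hx₁ : 0 ≤ x₁) (hy₀ : 0 ≤ y₀) (hy₁ : 0 ≤ y₁) :
    |x₀ - y₀| + |x₁ - y₁| ≤ |(x₀ + x₁) - (y₀ + y₁)| + 2 * (|x₁ * (y₀ + y₁) - y₁ * (x₀ + x₁)| / (y₀ + y₁)) := by
  rcases (add_nonneg hy₀ hy₁).eq_or_lt with hY | hY
  · have hy₀0 : y₀ = 0 := by linarith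
    have hy₁0 : y₁ = 0 := by linarith
    subst hy₀0; subst hy₁0
    rw [sub_zero, sub_zero, add_zero, sub_zero, div_zero, abs_of_nonneg hx₀, abs_of_nonneg hx₁, abs_of_nonneg (add_nonneg hx₀ hx₁)]
    linarith
  · set X := x₀ + x₁ with hX
    set Y := y₀ + y₁ with hYd
    -- `x₁ − y₁ = (x₁Y − y₁X)∕Y + (y₁∕Y)(X − Y)`, `x₀ − y₀ = (y₀∕Y)(X − Y) − (x₁Y − y₁X)∕Y`
    have e1 : x₁ - y₁ = (x₁ * Y - y₁ * X) / Y + y₁ / Y * (X - Y) := by field_simp; ring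
    have e0 : x₀ - y₀ = y₀ / Y * (X - Y) - (x₁ * Y - y₁ * X) / Y := by
      have : x₀ = X - x₁ := by rw [hX]; ring
      have : y₀ = Y - y₁ := by rw [hYd]; ring
      field_simp
      nlinarith
    have h1 : |x₁ - y₁| ≤ |x₁ * Y - y₁ * X| / Y + y₁ / Y * |X - Y| := by
      rw [e1]
      calc |(x₁ * Y - y₁ * X) / Y + y₁ / Y * (X - Y)| ≤ |(x₁ * Y - y₁ * X) / Y| + |y₁ / Y * (X - Y)| := abs_add_le _ _
        _ = |x₁ * Y - y₁ * X| / Y + y₁ / Y * |X - Y| := by rw [abs_div, abs_of_pos hY, abs_mul, abs_of_nonneg (div_nonneg hy₁ hY.le)]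
    have h0 : |x₀ - y₀| ≤ y₀ / Y * |X - Y| + |x₁ * Y - y₁ * X| / Y := by
      rw [e0]
      calc |y₀ / Y * (X - Y) - (x₁ * Y - y₁ * X) / Y| ≤ |y₀ / Y * (X - Y)| + |(x₁ * Y - y₁ * X) / Y| := abs_sub _ _
        _ = y₀ / Y * |X - Y| + |x₁ * Y - y₁ * X| / Y := by rw [abs_mul, abs_of_nonneg (div_nonneg hy₀ hY.le), abs_div, abs_of_pos hY]
    have hsum : y₀ / Y + y₁ / Y = 1 := by rw [← add_div, ← hYd, div_self hY.ne']
    nlinarith [abs_nonneg (X - Y)]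

/-- … and its UNIFORM form: a division-free conditional discrepancy `|x₁·Y − y₁·X| ≤ ε·X·Y` gives `|x₀ − y₀| + |x₁ − y₁| ≤ |X − Y| + 2ε·X`. [folklore] -/
theorem abs_sub_add_abs_sub_le_of_condDiscrepancy {x₀ x₁ y₀ y₁ ε : ℝ} (hx₀ : 0 ≤ x₀) (hx₁ : 0 ≤ x₁) (hy₀ : 0 ≤ y₀) (hy₁ : 0 ≤ y₁) (hε : 0 ≤ ε)
    (h : |x₁ * (y₀ + y₁) - y₁ * (x₀ + x₁)| ≤ ε * ((x₀ + x₁) * (y₀ + y₁))) :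
    |x₀ - y₀| + |x₁ - y₁| ≤ |(x₀ + x₁) - (y₀ + y₁)| + 2 * ε * (x₀ + x₁) := by
  have h0 := abs_sub_add_abs_sub_le_condGap hx₀ hx₁ hy₀ hy₁
  have hdiv : |x₁ * (y₀ + y₁) - y₁ * (x₀ + x₁)| / (y₀ + y₁) ≤ ε * (x₀ + x₁) := by
    rcases (add_nonneg hy₀ hy₁).eq_or_lt with hY | hY
    · rw [← hY, div_zero]; exact mul_nonneg hε (add_nonneg hx₀ hx₁)
    · rw [div_le_iff₀ hY]; nlinarith
  linarith

/-- ★★ **ONE STEP OF THE CHAIN RULE, MASS-WEIGHTED** [folklore]: let `P, Q` be non-negative weight functions on the configurations `S ⊆ insert a U` (`a ∉ U`) with MARGINALS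
`P_U(S) = P(S) + P(S ∪ {a})`; then `Σ_{S' ⊆ U∪{a}} |P(S') − Q(S')| ≤ Σ_{S⊆U} |P_U(S) − Q_U(S)| + 2·Σ_{S⊆U} |P(S∪{a})·Q_U(S) − Q(S∪{a})·P_U(S)| ∕ Q_U(S)` — the added cost is twice the
`P_U`-AVERAGED gap of the two CONDITIONAL probabilities «block `a` large-field given the old configuration `S`» (a conditional gap on a `P_U`-negligible past costs nothing). NO independence. -/
theorem l1_succ_le_add_two_mul_avgCondGap {U : Finset ι} {a : ι} (ha : a ∉ U) {P Q : Finset ι → ℝ}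
    (hP : ∀ S ⊆ insert a U, 0 ≤ P S) (hQ : ∀ S ⊆ insert a U, 0 ≤ Q S) :
    ∑ S ∈ (insert a U).powerset, |P S - Q S| ≤ ∑ S ∈ U.powerset, |(P S + P (insert a S)) - (Q S + Q (insert a S))| +
      2 * ∑ S ∈ U.powerset, |P (insert a S) * (Q S + Q (insert a S)) - Q (insert a S) * (P S + P (insert a S))| / (Q S + Q (insert a S)) := by
  rw [Finset.sum_powerset_insert ha, ← Finset.sum_add_distrib, Finset.mul_sum, ← Finset.sum_add_distrib]
  refine Finset.sum_le_sum fun S hS => ?_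
  have hS' : S ⊆ U := Finset.mem_powerset.1 hS
  have hSU : S ⊆ insert a U := hS'.trans (Finset.subset_insert a U)
  have haSU : insert a S ⊆ insert a U := Finset.insert_subset_insert a hS'
  exact abs_sub_add_abs_sub_le_condGap (hP S hSU) (hP _ haSU) (hQ S hSU) (hQ _ haSU)

/-- ★★ **ONE STEP OF THE CHAIN RULE** [folklore]: let `P, Q` be non-negative weight functions on the configurations `S ⊆ insert a U` (`a ∉ U`) of `|U| + 1` blocks, with MARGINALS
`P_U(S) = P(S) + P(S ∪ {a})` on the old blocks; if for every old configuration `S ⊆ U` the two CONDITIONAL probabilities «block `a` large-field given `S`» differ by at most `ε`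
(division-free: `|P(S∪{a})·Q_U(S) − Q(S∪{a})·P_U(S)| ≤ ε·P_U(S)·Q_U(S)`), then `Σ_{S' ⊆ U∪{a}} |P(S') − Q(S')| ≤ Σ_{S ⊆ U} |P_U(S) − Q_U(S)| + 2ε·Σ_{S⊆U} P_U(S)` — NO independence. -/
theorem l1_succ_le_of_condDiscrepancy {U : Finset ι} {a : ι} (ha : a ∉ U) {P Q : Finset ι → ℝ} {ε : ℝ} (hε : 0 ≤ ε)
    (hP : ∀ S ⊆ insert a U, 0 ≤ P S) (hQ : ∀ S ⊆ insert a U, 0 ≤ Q S)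
    (hcond : ∀ S ⊆ U, |P (insert a S) * (Q S + Q (insert a S)) - Q (insert a S) * (P S + P (insert a S))| ≤ ε * ((P S + P (insert a S)) * (Q S + Q (insert a S)))) :
    ∑ S ∈ (insert a U).powerset, |P S - Q S| ≤ ∑ S ∈ U.powerset, |(P S + P (insert a S)) - (Q S + Q (insert a S))| + 2 * ε * ∑ S ∈ U.powerset, (P S + P (insert a S)) := by
  rw [Finset.sum_powerset_insert ha, ← Finset.sum_add_distrib, Finset.mul_sum, ← Finset.sum_add_distrib]
  refine Finset.sum_le_sum fun S hS => ?_
  have hS' : S ⊆ U := Finset.mem_powerset.1 hS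
  have hSU : S ⊆ insert a U := hS'.trans (Finset.subset_insert a U)
  have haSU : insert a S ⊆ insert a U := Finset.insert_subset_insert a hS'
  exact abs_sub_add_abs_sub_le_of_condDiscrepancy (hP S hSU) (hP _ haSU) (hQ S hSU) (hQ _ haSU) hε (hcond S hS')

end OneStep

/-! ## §2 The tower telescopes: ℓ¹ ≤ 2·Σ_i ε_i for two probability towers -/

section Tower

variable (P Q : ℕ → Finset ℕ → ℝ) (ε : ℕ → ℝ)

/-- ★★★ **THE CONDITIONAL HYBRID BOUND, MASS-WEIGHTED** [folklore]: two TOWERS OF MARGINALS `P_i, Q_i` (`i ≤ n`; `P_i` a non-negative weight function on `(range i).powerset`,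
consistent: `P_i(S) = P_{i+1}(S) + P_{i+1}(S ∪ {i})`) satisfy
`Σ_{S ⊆ range n} |P_n(S) − Q_n(S)| ≤ |P_0(∅) − Q_0(∅)| + 2·Σ_{i<n} Σ_{S ⊆ range i} |P_{i+1}(S∪{i})·Q_i(S) − Q_{i+1}(S∪{i})·P_i(S)| ∕ Q_i(S)` — the chain rule for total variation along a
filtration, each block paying its `P_i`-AVERAGED conditional two-law gap; NO independence, NO product structure, NO uniformity in the past. -/
theorem l1_le_of_avgCondGapTower (n : ℕ)
    (hP : ∀ i ≤ n, ∀ S ⊆ Finset.range i, 0 ≤ P i S) (hQ : ∀ i ≤ n, ∀ S ⊆ Finset.range i, 0 ≤ Q i S)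
    (hPc : ∀ i < n, ∀ S ⊆ Finset.range i, P i S = P (i + 1) S + P (i + 1) (insert i S))
    (hQc : ∀ i < n, ∀ S ⊆ Finset.range i, Q i S = Q (i + 1) S + Q (i + 1) (insert i S)) :
    ∑ S ∈ (Finset.range n).powerset, |P n S - Q n S| ≤ |P 0 ∅ - Q 0 ∅| +
      2 * ∑ i ∈ Finset.range n, ∑ S ∈ (Finset.range i).powerset, |P (i + 1) (insert i S) * Q i S - Q (i + 1) (insert i S) * P i S| / Q i S := by
  induction n with
  | zero => simp
  | succ n IH =>
    have IH' := IH (fun i hi => hP i (Nat.le_succ_of_le hi)) (fun i hi => hQ i (Nat.le_succ_of_le hi))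
      (fun i hi => hPc i (Nat.lt_succ_of_lt hi)) (fun i hi => hQc i (Nat.lt_succ_of_lt hi))
    have hstep := l1_succ_le_add_two_mul_avgCondGap (U := Finset.range n) (a := n) Finset.notMem_range_self (P := P (n + 1)) (Q := Q (n + 1))
      (fun S hS => hP (n + 1) le_rfl S (by rwa [Finset.range_add_one])) (fun S hS => hQ (n + 1) le_rfl S (by rwa [Finset.range_add_one]))
    rw [Finset.sum_range_succ, Finset.range_add_one]
    have e1 : ∑ S ∈ (Finset.range n).powerset, |(P (n + 1) S + P (n + 1) (insert n S)) - (Q (n + 1) S + Q (n + 1) (insert n S))| =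
        ∑ S ∈ (Finset.range n).powerset, |P n S - Q n S| :=
      Finset.sum_congr rfl fun S hS => by rw [← hPc n (Nat.lt_succ_self n) S (Finset.mem_powerset.1 hS), ← hQc n (Nat.lt_succ_self n) S (Finset.mem_powerset.1 hS)]
    have e2 : ∑ S ∈ (Finset.range n).powerset, |P (n + 1) (insert n S) * (Q (n + 1) S + Q (n + 1) (insert n S)) -
          Q (n + 1) (insert n S) * (P (n + 1) S + P (n + 1) (insert n S))| / (Q (n + 1) S + Q (n + 1) (insert n S)) =
        ∑ S ∈ (Finset.range n).powerset, |P (n + 1) (insert n S) * Q n S - Q (n + 1) (insert n S) * P n S| / Q n S :=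
      Finset.sum_congr rfl fun S hS => by rw [← hPc n (Nat.lt_succ_self n) S (Finset.mem_powerset.1 hS), ← hQc n (Nat.lt_succ_self n) S (Finset.mem_powerset.1 hS)]
    rw [e1, e2] at hstep
    linarith

/-- ★★★ **THE CONDITIONAL HYBRID BOUND** [folklore]: two TOWERS OF MARGINALS `P_i, Q_i` (`i ≤ n`; `P_i` a non-negative weight function on `(range i).powerset`, consistent:
`P_i(S) = P_{i+1}(S) + P_{i+1}(S ∪ {i})`) whose block-`i` CONDITIONALS given every earlier configuration differ by at most `ε_i ≥ 0`
(`|P_{i+1}(S∪{i})·Q_i(S) − Q_{i+1}(S∪{i})·P_i(S)| ≤ ε_i·P_i(S)·Q_i(S)` for `S ⊆ range i`) satisfy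
`Σ_{S ⊆ range n} |P_n(S) − Q_n(S)| ≤ |P_0(∅) − Q_0(∅)| + 2·(Σ_{i<n} ε_i)·P_0(∅)` — the chain rule for total variation along a filtration; NO independence, NO product structure. -/
theorem l1_le_of_condDiscrepancyTower (n : ℕ) (hε : ∀ i < n, 0 ≤ ε i)
    (hP : ∀ i ≤ n, ∀ S ⊆ Finset.range i, 0 ≤ P i S) (hQ : ∀ i ≤ n, ∀ S ⊆ Finset.range i, 0 ≤ Q i S)
    (hPc : ∀ i < n, ∀ S ⊆ Finset.range i, P i S = P (i + 1) S + P (i + 1) (insert i S))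
    (hQc : ∀ i < n, ∀ S ⊆ Finset.range i, Q i S = Q (i + 1) S + Q (i + 1) (insert i S))
    (hcond : ∀ i < n, ∀ S ⊆ Finset.range i,
      |P (i + 1) (insert i S) * Q i S - Q (i + 1) (insert i S) * P i S| ≤ ε i * (P i S * Q i S)) :
    ∑ S ∈ (Finset.range n).powerset, |P n S - Q n S| ≤ |P 0 ∅ - Q 0 ∅| + 2 * (∑ i ∈ Finset.range n, ε i) * P 0 ∅ := by
  -- the total of `P_i` is `P_0(∅)` for every `i ≤ n`
  have htot : ∀ i ≤ n, ∑ S ∈ (Finset.range i).powerset, P i S = P 0 ∅ := by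
    intro i hi
    induction i with
    | zero => simp
    | succ i IH =>
      rw [Finset.range_add_one, Finset.sum_powerset_insert Finset.notMem_range_self, ← Finset.sum_add_distrib, ← IH (Nat.le_of_succ_le hi)]
      exact Finset.sum_congr rfl fun S hS => (hPc i (Nat.lt_of_succ_le hi) S (Finset.mem_powerset.1 hS)).symm
  -- each averaged gap is at most `ε_i · (total of P_i) = ε_i · P_0(∅)`
  have hγ : ∀ i ∈ Finset.range n, ∑ S ∈ (Finset.range i).powerset, |P (i + 1) (insert i S) * Q i S - Q (i + 1) (insert i S) * P i S| / Q i S ≤ ε i * P 0 ∅ := by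
    intro i hi
    have hi' := Finset.mem_range.1 hi
    rw [← htot i hi'.le, Finset.mul_sum]
    refine Finset.sum_le_sum fun S hS => ?_
    have hS' := Finset.mem_powerset.1 hS
    have hPi := hP i hi'.le S hS'
    rcases (hQ i hi'.le S hS').eq_or_lt with hQ0 | hQpos
    · rw [← hQ0, div_zero]; exact mul_nonneg (hε i hi') hPi
    · rw [div_le_iff₀ hQpos]; nlinarith [hcond i hi' S hS']
  have h := l1_le_of_avgCondGapTower P Q n hP hQ hPc hQc
  have hs := Finset.sum_le_sum hγ
  rw [← Finset.sum_mul] at hs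
  linarith

/-- ★★★ **PROBABILITY TOWERS**: if both towers start from the unit point mass (`P_0(∅) = Q_0(∅) = 1`), then `Σ_{S ⊆ range n} |P_n(S) − Q_n(S)| ≤ 2·Σ_{i<n} ε_i` — the two laws of the
`n` blocks' large-field configuration are TV-close by the sum of the per-block CONDITIONAL discrepancies.  The independent-block caricature (FILE Q `l1_prodConfig_le_two_mul_blockDiscrepancy`)
is the case of conditionals blind to the past (`ε_i = |q_i − p_i|`). [folklore] -/
theorem l1_le_two_mul_sum_condDiscrepancy (n : ℕ) (hε : ∀ i < n, 0 ≤ ε i)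
    (hP : ∀ i ≤ n, ∀ S ⊆ Finset.range i, 0 ≤ P i S) (hQ : ∀ i ≤ n, ∀ S ⊆ Finset.range i, 0 ≤ Q i S) (hP0 : P 0 ∅ = 1) (hQ0 : Q 0 ∅ = 1)
    (hPc : ∀ i < n, ∀ S ⊆ Finset.range i, P i S = P (i + 1) S + P (i + 1) (insert i S))
    (hQc : ∀ i < n, ∀ S ⊆ Finset.range i, Q i S = Q (i + 1) S + Q (i + 1) (insert i S))
    (hcond : ∀ i < n, ∀ S ⊆ Finset.range i,
      |P (i + 1) (insert i S) * Q i S - Q (i + 1) (insert i S) * P i S| ≤ ε i * (P i S * Q i S)) :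
    ∑ S ∈ (Finset.range n).powerset, |P n S - Q n S| ≤ 2 * ∑ i ∈ Finset.range n, ε i := by
  have h := l1_le_of_condDiscrepancyTower P Q ε n hε hP hQ hPc hQc hcond
  rw [hP0, hQ0, sub_self, abs_zero, zero_add, mul_one] at h
  exact h

end Tower

/-! ## §3 Along `K`, in the tree's class-law currency: the TV radius from a summable conditional tower, and `HybridNE7` with node U5's target -/

section AlongK

variable {l₀ vol : ℝ} (n : ℕ → ℕ) (A B : ℕ → ℝ → Finset ℕ → ℝ) (PA PB : ℕ → ℝ → ℕ → Finset ℕ → ℝ) (ε : ℕ → ℕ → ℝ)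

/-- ★★ **EVERY CLASS-SET GAP IS AT MOST THE SUMMED CONDITIONAL DISCREPANCY** [folklore ∕ bookkeeping]: class weights `A_K(t,·), B_K(t,·)` on the configurations `S ⊆ range n_K`
with positive totals, and for each `(K, t)` NORMALISED towers `PA_K(t)_i, PB_K(t)_i` (unit point mass at level `0`, consistent, non-negative) ending at the normalised class laws
(`PA_K(t)_{n_K} = A_K(t,·)∕Σ A_K(t,·)`), with conditional discrepancies `ε_{K,i} ≥ 0` UNIFORM in `|t| ≤ l₀` ⇒ `|Σ_𝒮 A∕Σ A − Σ_𝒮 B∕Σ B| ≤ Σ_{i<n_K} ε_{K,i}` for every class set `𝒮`. -/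
theorem classLawGap_le_sum_condDiscrepancy
    (hZA : ∀ (K : ℕ) (t : ℝ), |t| ≤ l₀ → 0 < ∑ S ∈ (Finset.range (n K)).powerset, A K t S)
    (hZB : ∀ (K : ℕ) (t : ℝ), |t| ≤ l₀ → 0 < ∑ S ∈ (Finset.range (n K)).powerset, B K t S)
    (hε : ∀ K, ∀ i < n K, 0 ≤ ε K i)
    (hPA : ∀ (K : ℕ) (t : ℝ), |t| ≤ l₀ → (∀ i ≤ n K, ∀ S ⊆ Finset.range i, 0 ≤ PA K t i S) ∧ PA K t 0 ∅ = 1 ∧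
      (∀ i < n K, ∀ S ⊆ Finset.range i, PA K t i S = PA K t (i + 1) S + PA K t (i + 1) (insert i S)) ∧
      ∀ S ∈ (Finset.range (n K)).powerset, PA K t (n K) S = A K t S / ∑ S' ∈ (Finset.range (n K)).powerset, A K t S')
    (hPB : ∀ (K : ℕ) (t : ℝ), |t| ≤ l₀ → (∀ i ≤ n K, ∀ S ⊆ Finset.range i, 0 ≤ PB K t i S) ∧ PB K t 0 ∅ = 1 ∧
      (∀ i < n K, ∀ S ⊆ Finset.range i, PB K t i S = PB K t (i + 1) S + PB K t (i + 1) (insert i S)) ∧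
      ∀ S ∈ (Finset.range (n K)).powerset, PB K t (n K) S = B K t S / ∑ S' ∈ (Finset.range (n K)).powerset, B K t S')
    (hcond : ∀ (K : ℕ) (t : ℝ), |t| ≤ l₀ → ∀ i < n K, ∀ S ⊆ Finset.range i,
      |PA K t (i + 1) (insert i S) * PB K t i S - PB K t (i + 1) (insert i S) * PA K t i S| ≤ ε K i * (PA K t i S * PB K t i S))
    (K : ℕ) (t : ℝ) (ht : |t| ≤ l₀) (𝒮 : Finset (Finset ℕ)) (h𝒮 : 𝒮 ⊆ (Finset.range (n K)).powerset) :
    |(∑ S ∈ 𝒮, A K t S) / (∑ S ∈ (Finset.range (n K)).powerset, A K t S) - (∑ S ∈ 𝒮, B K t S) / (∑ S ∈ (Finset.range (n K)).powerset, B K t S)| ≤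
      ∑ i ∈ Finset.range (n K), ε K i := by
  obtain ⟨hPA0, hPA1, hPAc, hPAn⟩ := hPA K t ht
  obtain ⟨hPB0, hPB1, hPBc, hPBn⟩ := hPB K t ht
  have hl1 := l1_le_two_mul_sum_condDiscrepancy (PA K t) (PB K t) (ε K) (n K) (hε K) hPA0 hPB0 hPA1 hPB1 hPAc hPBc (hcond K t ht)
  -- the normalised laws have equal (unit) totals, so every class-set gap is at most half their ℓ¹ distance (FILE A)
  have htotA : ∑ S ∈ (Finset.range (n K)).powerset, PA K t (n K) S = 1 := by
    rw [Finset.sum_congr rfl fun S hS => hPAn S hS, ← Finset.sum_div, div_self (hZA K t ht).ne']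
  have htotB : ∑ S ∈ (Finset.range (n K)).powerset, PB K t (n K) S = 1 := by
    rw [Finset.sum_congr rfl fun S hS => hPBn S hS, ← Finset.sum_div, div_self (hZB K t ht).ne']
  have hhalf := abs_sub_le_half_sum_abs (Finset.range (n K)).powerset (a := PA K t (n K)) (b := PB K t (n K)) (htotA.trans htotB.symm) h𝒮
  have eA : (∑ S ∈ 𝒮, A K t S) / (∑ S ∈ (Finset.range (n K)).powerset, A K t S) = ∑ S ∈ 𝒮, PA K t (n K) S := by
    rw [Finset.sum_div]; exact Finset.sum_congr rfl fun S hS => (hPAn S (h𝒮 hS)).symm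
  have eB : (∑ S ∈ 𝒮, B K t S) / (∑ S ∈ (Finset.range (n K)).powerset, B K t S) = ∑ S ∈ 𝒮, PB K t (n K) S := by
    rw [Finset.sum_div]; exact Finset.sum_congr rfl fun S hS => (hPBn S (h𝒮 hS)).symm
  have hcomm : ∑ S ∈ (Finset.range (n K)).powerset, |PB K t (n K) S - PA K t (n K) S| = ∑ S ∈ (Finset.range (n K)).powerset, |PA K t (n K) S - PB K t (n K) S| :=
    Finset.sum_congr rfl fun S _ => abs_sub_comm _ _
  rw [eA, eB, abs_sub_comm]
  rw [hcomm] at hhalf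
  linarith

/-- ★★★ **`HybridNE7` FROM NODE U5's TARGET AND A SUMMABLE CONDITIONAL TOWER — NO INDEPENDENCE** [folklore ∕ bookkeeping]: in the setting of `classLawGap_le_sum_condDiscrepancy`, with
the E1∕E2 dictionary to `Z`, node U5's `Target vol l₀ δ Z` on the totals, `Σ_K Σ_{i<n_K} ε_{K,i} < ∞` and `Σ_{i<n_K} ε_{K,i} < 1` at every `K`, SOME shells give
`HybridNE7 l₀ vol T A B ∅ 0 shA shB (K ↦ Σ_i ε_{K,i}) δ` — dag-n20-w4's class-law road `exists_hybridNE7_of_target_of_classLawTV` BY NAME.  At a window key: stub 2's three hybrid faces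
from the Target plus a summable tower of per-block CONDITIONAL two-run large-field discrepancies. -/
theorem exists_hybridNE7_of_target_of_condDiscrepancyTower (hl₀ : 0 ≤ l₀)
    (hA : ∀ (K : ℕ) (t : ℝ), |t| ≤ l₀ → ∀ S ∈ (Finset.range (n K)).powerset, 0 ≤ A K t S)
    (hB : ∀ (K : ℕ) (t : ℝ), |t| ≤ l₀ → ∀ S ∈ (Finset.range (n K)).powerset, 0 ≤ B K t S)
    (hZA : ∀ (K : ℕ) (t : ℝ), |t| ≤ l₀ → 0 < ∑ S ∈ (Finset.range (n K)).powerset, A K t S)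
    (hZB : ∀ (K : ℕ) (t : ℝ), |t| ≤ l₀ → 0 < ∑ S ∈ (Finset.range (n K)).powerset, B K t S)
    {Z : ℕ → ℝ → ℝ} (hZA' : ∀ (K : ℕ) (t : ℝ), |t| ≤ l₀ → Z K t = ∑ S ∈ (Finset.range (n K)).powerset, A K t S)
    (hZB' : ∀ (K : ℕ) (t : ℝ), |t| ≤ l₀ → Z (K + 1) t = ∑ S ∈ (Finset.range (n K)).powerset, B K t S) {δ : ℕ → ℝ} (hT : Target vol l₀ δ Z)
    (hε : ∀ K, ∀ i < n K, 0 ≤ ε K i) (hε1 : ∀ K, ∑ i ∈ Finset.range (n K), ε K i < 1) (hεs : Summable fun K => ∑ i ∈ Finset.range (n K), ε K i)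
    (hPA : ∀ (K : ℕ) (t : ℝ), |t| ≤ l₀ → (∀ i ≤ n K, ∀ S ⊆ Finset.range i, 0 ≤ PA K t i S) ∧ PA K t 0 ∅ = 1 ∧
      (∀ i < n K, ∀ S ⊆ Finset.range i, PA K t i S = PA K t (i + 1) S + PA K t (i + 1) (insert i S)) ∧
      ∀ S ∈ (Finset.range (n K)).powerset, PA K t (n K) S = A K t S / ∑ S' ∈ (Finset.range (n K)).powerset, A K t S')
    (hPB : ∀ (K : ℕ) (t : ℝ), |t| ≤ l₀ → (∀ i ≤ n K, ∀ S ⊆ Finset.range i, 0 ≤ PB K t i S) ∧ PB K t 0 ∅ = 1 ∧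
      (∀ i < n K, ∀ S ⊆ Finset.range i, PB K t i S = PB K t (i + 1) S + PB K t (i + 1) (insert i S)) ∧
      ∀ S ∈ (Finset.range (n K)).powerset, PB K t (n K) S = B K t S / ∑ S' ∈ (Finset.range (n K)).powerset, B K t S')
    (hcond : ∀ (K : ℕ) (t : ℝ), |t| ≤ l₀ → ∀ i < n K, ∀ S ⊆ Finset.range i,
      |PA K t (i + 1) (insert i S) * PB K t i S - PB K t (i + 1) (insert i S) * PA K t i S| ≤ ε K i * (PA K t i S * PB K t i S)) :
    ∃ shA shB : ℕ → ℝ → Finset ℕ → ℝ,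
      HybridNE7 l₀ vol (fun K => (Finset.range (n K)).powerset) A B (fun _ _ => ∅) (fun _ => 0) shA shB (fun K => ∑ i ∈ Finset.range (n K), ε K i) δ :=
  exists_hybridNE7_of_target_of_classLawTV (T := fun K => (Finset.range (n K)).powerset) hl₀ hA hB hZA hZB hZA' hZB' hT
    (fun K => Finset.sum_nonneg fun i hi => hε K i (Finset.mem_range.1 hi)) hε1 hεs
    (fun K t ht 𝒮 h𝒮 => classLawGap_le_sum_condDiscrepancy n A B PA PB ε hZA hZB hε hPA hPB hcond K t ht 𝒮 h𝒮)

/-- THE WINDOW INSTANCE OF THE LETTER [bookkeeping]: boundedly many blocks (`n_K ≤ N`) whose conditional discrepancies contract geometrically in the cutoff (`0 ≤ ε_{K,i} ≤ ρ·θ^K`,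
`0 ≤ θ < 1`) give a SUMMABLE tower letter `Σ_K Σ_{i<n_K} ε_{K,i} < ∞` — FILE M's `…_of_boundedBlocks_of_geometric` without independence (the `< 1` row of the previous theorem
holds from the first `K` with `N·ρ·θ^K < 1`). -/
theorem summable_sum_condDiscrepancy_of_boundedBlocks_of_geometric {N : ℕ} {ρ θ : ℝ} (hρ : 0 ≤ ρ) (hθ0 : 0 ≤ θ) (hθ1 : θ < 1)
    (hn : ∀ K, n K ≤ N) (hε0 : ∀ K, ∀ i < n K, 0 ≤ ε K i) (hε : ∀ K, ∀ i < n K, ε K i ≤ ρ * θ ^ K) :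
    Summable fun K => ∑ i ∈ Finset.range (n K), ε K i := by
  refine Summable.of_nonneg_of_le (fun K => Finset.sum_nonneg fun i hi => hε0 K i (Finset.mem_range.1 hi)) (fun K => ?_)
    ((summable_geometric_of_lt_one hθ0 hθ1).mul_left (N * ρ))
  calc ∑ i ∈ Finset.range (n K), ε K i ≤ ∑ _i ∈ Finset.range (n K), ρ * θ ^ K := Finset.sum_le_sum fun i hi => hε K i (Finset.mem_range.1 hi)
    _ = n K * (ρ * θ ^ K) := by rw [Finset.sum_const, Finset.card_range, nsmul_eq_mul]
    _ ≤ N * (ρ * θ ^ K) := mul_le_mul_of_nonneg_right (by exact_mod_cast hn K) (mul_nonneg hρ (pow_nonneg hθ0 _))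
    _ = N * ρ * θ ^ K := by ring

end AlongK

end Summit.QuantumFields.YangMills.BalabanUVNodes.N20ClassLawConditionalHybridBound

end
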